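import Literature.Geometry.GeometricMeasureTheory.RectifiableImagePieceData

/-!
# Image pieces over a general parameter inner product space

The results of `RectifiableImagePiece.lean` / `RectifiableImagePieceData.lean` on bi-Lipschitz
images `F(E)` of measurable pieces were stated for the parameter space `ℝᵐ = EuclideanSpace ℝ (Fin m)`.
Here they are transported along the isometry `e.repr : P ≃ₗᵢ ℝⁿ` of an orthonormal basis `e` to an
arbitrary finite-dimensional real inner product space `P` (needed for parameter spaces such as
`ℝ × ℝᵐ` in the push-forward of product currents):

* `ae_approxTangentCone_image_eq_range'` — `Tan^n(𝓗ⁿ ⌞ F(E), F u) = im DF(u)` for a.e. point;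
* `isCountablyRectifiable_of_subset_image_lipschitzOnWith'`;
* `isRectifiableData_image_density'` — `(F(E), θ̃ ∘ F⁻¹, GS(F' e))` are admissible rectifiable data.

Theorems only; no named facts.

## References

* H. Federer, *Geometric Measure Theory*, Springer 1969, 3.2.19, 4.1.28, 4.1.30 [Federer1969].
-/

noncomputable section

open scoped InnerProductSpace ENNReal NNReal Topology
open MeasureTheory MeasureTheory.Measure Set Function Filter Module InnerProductSpace TopologicalSpace
open Literature.Analysis.Calculus

namespace Literature.Geometry.GeometricMeasureTheory

-- Nested operator-norm instances on (duals of) `V [⋀^Fin n]→L[ℝ] ℝ`.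
set_option maxSynthPendingDepth 2

variable {P : Type*} [NormedAddCommGroup P] [InnerProductSpace ℝ P] [FiniteDimensional ℝ P]
  [MeasurableSpace P] [BorelSpace P]
  {W : Type*} [NormedAddCommGroup W] [InnerProductSpace ℝ W] [FiniteDimensional ℝ W]
  [MeasurableSpace W] [BorelSpace W] {n : ℕ}
  {F : P → W} {F' : P → P →L[ℝ] W} {E : Set P}

omit [MeasurableSpace P] [BorelSpace P] [FiniteDimensional ℝ P] in
/-- **`Tan^n(𝓗ⁿ ⌞ F(E), F u) = im DF(u)` a.e. on a bi-Lipschitz piece**, general parameter space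
(transport of `ae_approxTangentCone_image_eq_range` along `e.repr`). [cite: Federer1969, 3.2.19] -/
theorem ae_approxTangentCone_image_eq_range' (e : OrthonormalBasis (Fin n) ℝ P)
    (hF : ∀ u ∈ E, HasFDerivWithinAt F (F' u) E u) (hinj : ∀ u ∈ E, Injective (F' u))
    {K : ℝ≥0} (hanti : AntilipschitzWith K (E.restrict F)) {L : ℝ≥0} (hlip : LipschitzOnWith L F E)
    (hFE : MeasurableSet (F '' E)) :
    ∀ᵐ y ∂((μHE[n] : Measure W).restrict (F '' E)), ∀ u ∈ E, F u = y →
      approxTangentCone n ((μHE[n] : Measure W).restrict (F '' E)) y = range (F' u) := by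
  set ι := e.repr with hι
  set Fe : EuclideanSpace ℝ (Fin n) → W := F ∘ ι.symm with hFe
  set Ee : Set (EuclideanSpace ℝ (Fin n)) := ι '' E with hEe
  set Fe' : EuclideanSpace ℝ (Fin n) → EuclideanSpace ℝ (Fin n) →L[ℝ] W :=
    fun v => (F' (ι.symm v)).comp (ι.symm : EuclideanSpace ℝ (Fin n) →L[ℝ] P) with hFe'
  have hmem : ∀ {v}, v ∈ Ee → ι.symm v ∈ E := by
    rintro v ⟨u, hu, rfl⟩
    simpa using hu
  have hmaps : MapsTo ι.symm Ee E := fun v hv => hmem hv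
  have himage : Fe '' Ee = F '' E := by
    rw [hEe, image_image]
    refine image_congr fun u _ => ?_
    simp [hFe]
  have hFe_d : ∀ v ∈ Ee, HasFDerivWithinAt Fe (Fe' v) Ee v := fun v hv =>
    (hF _ (hmem hv)).comp v (ι.symm : EuclideanSpace ℝ (Fin n) →L[ℝ] P).hasFDerivWithinAt hmaps
  have hFe_inj : ∀ v ∈ Ee, Injective (Fe' v) := fun v hv =>
    (hinj _ (hmem hv)).comp ι.symm.injective
  have hFe_anti : AntilipschitzWith K (Ee.restrict Fe) := by
    refine AntilipschitzWith.of_le_mul_dist fun a b => ?_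
    have h := hanti.le_mul_dist ⟨ι.symm a, hmem a.2⟩ ⟨ι.symm b, hmem b.2⟩
    simp only [Subtype.dist_eq, Set.restrict_apply] at h ⊢
    rw [← ι.symm.dist_map a b]
    simpa [hFe] using h
  have hFe_lip : LipschitzOnWith L Fe Ee := by
    refine LipschitzOnWith.of_dist_le_mul fun a ha b hb => ?_
    have h := hlip.dist_le_mul (ι.symm a) (hmem ha) (ι.symm b) (hmem hb)
    rw [ι.symm.dist_map] at h
    simpa [hFe] using h
  have hFeE : MeasurableSet (Fe '' Ee) := by rwa [himage]
  have h := ae_approxTangentCone_image_eq_range hFe_d hFe_inj hFe_anti hFe_lip hFeE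
  rw [himage] at h
  filter_upwards [h] with y hy u hu hFu
  have hv : ι u ∈ Ee := mem_image_of_mem _ hu
  have h1 := hy (ι u) hv (by simp [hFe, hFu])
  rw [h1, hFe']
  simp only [LinearIsometryEquiv.symm_apply_apply, ContinuousLinearMap.coe_comp,
    LinearIsometryEquiv.coe_coe'']
  exact (ι.symm.surjective.range_comp _)

omit [MeasurableSpace P] [BorelSpace P] [FiniteDimensional ℝ P] in
/-- A set contained in a Lipschitz image of a subset of `P` (`dim P = n`) is countably
`n`-rectifiable. [cite: Federer1969, 3.2.14] -/
theorem isCountablyRectifiable_of_subset_image_lipschitzOnWith' (e : OrthonormalBasis (Fin n) ℝ P)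
    {L : ℝ≥0} (hlip : LipschitzOnWith L F E) {S : Set W} (hS : S ⊆ F '' E) :
    IsCountablyRectifiable n S := by
  obtain ⟨g, hg, hgE⟩ := hlip.extend_finite_dimension
  refine ⟨fun _ => g ∘ e.repr.symm, fun _ => ⟨_, hg.comp e.repr.symm.lipschitz⟩, ?_⟩
  have : S \ ⋃ _i : ℕ, range (g ∘ e.repr.symm) = ∅ := by
    refine eq_empty_iff_forall_notMem.2 fun y hy => hy.2 ?_
    obtain ⟨x, hx, rfl⟩ := hS hy.1
    exact mem_iUnion.2 ⟨0, ⟨e.repr x, by simp [(hgE hx).symm]⟩⟩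
  rw [this, measure_empty]

/-- **The image of a bi-Lipschitz piece with integer density gives admissible rectifiable data**,
general parameter inner product space `P` with an orthonormal basis `e` (as
`isRectifiableData_image_density`). [cite: Federer1969, 4.1.28 (4), 3.2.19, 4.1.30] -/
theorem isRectifiableData_image_density' (e : OrthonormalBasis (Fin n) ℝ P) (hs : MeasurableSet E)
    (hF : ∀ u ∈ E, HasFDerivWithinAt F (F' u) E u) (hinj : ∀ u ∈ E, Injective (F' u))
    {K : ℝ≥0} (hanti : AntilipschitzWith K (E.restrict F)) {L : ℝ≥0} (hlip : LipschitzOnWith L F E)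
    {θ : P → ℤ} (hθ : IntegrableOn (fun u => (θ u : ℝ) • frameVector fun j => F' u (e j)) E)
    {Ω : Opens W} (hΩ : F '' E ⊆ Ω) :
    IsRectifiableData Ω n (F '' E) (imageDensity F E θ) (imageFrame F F' E e) := by
  have hFi : InjOn F E := fun a ha b hb h => by
    have := hanti.injective (a₁ := ⟨a, ha⟩) (a₂ := ⟨b, hb⟩) (by simpa using h)
    exact congrArg Subtype.val this
  have hWm := measurableSet_image_of_hasFDerivWithinAt hs hF hFi
  refine ⟨hWm, hΩ, isCountablyRectifiable_of_subset_image_lipschitzOnWith' e hlip Subset.rfl, ?_, ?_⟩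
  · have hint := (integrableOn_imageDensity_smul_frameVector_iff hs hF hinj hFi e θ).2 hθ
    exact (hint.integrable.locallyIntegrable).locallyIntegrableOn _
  · have hae := ae_approxTangentCone_image_eq_range' e hF hinj hanti hlip hWm
    have hmem : ∀ᵐ y ∂((μHE[n] : Measure W).restrict (F '' E)), y ∈ F '' E := ae_restrict_mem hWm
    filter_upwards [hae, hmem] with y hy hymem
    obtain ⟨x, hx, rfl⟩ := hymem
    rw [imageFrame_apply_image hFi e hx]
    refine ⟨orthonormal_gramSchmidtNormed_comp (hinj x hx) e, ?_⟩
    rw [hy x hx rfl, span_gramSchmidtNormed_comp, LinearMap.coe_range]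
    rfl

end Literature.Geometry.GeometricMeasureTheory
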